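import Summits.KontsevichZagierPeriods.KontsevichZagierPeriods.Theorems.UnfoldedStokesStokesGenerationFibrewiseRungDlogSwap
import Summits.KontsevichZagierPeriods.KontsevichZagierPeriods.Theorems.UnfoldedStokesStokesGenerationStubSaSwapTransport
import Summits.KontsevichZagierPeriods.KontsevichZagierPeriods.Theorems.UnfoldedStokesDefs

/-!
# `StokesGeneration` (stmt-KontsevichZagierPeriods-3586), line `fibrewise_stokes` — rung 10d: the dlog transposition for semialgebraic units

Crux `Summit.KontsevichZagierPeriods.KontsevichZagierPeriods.Theses.UnfoldedStokes.StokesGeneration`; residual S2 =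
`FibrewiseStokesGenerationConjecture` (decomposability WITHOUT the change-of-variables move). Rung 10 (lead c5) generalises the
Baker layer from polynomial to SEMIALGEBRAIC data. This file (`fibStokesDecomposable_saDlogSwap`): for positive `ℚ`-semialgebraic `C¹`
units `p, q` on `[0,1]` with the same logarithmic period `p(1)/p(0) = q(1)/q(0)` and `γ` algebraic, the coordinate transposition
`γ(p′(x₀)/p(x₀) − q′(x₁)/q(x₁))` is fibrewise-Stokes decomposable on the square — rung 6 (p128879) verbatim with functions: the
semialgebraic closed-form transport on the 4-cube (`stub_saSwapTransport`, p132805) leaves two boundary loops with constant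
fibre periods, closed up by the atom `(r − 1)/(1 + y(r − 1))` and certified by rung 1 with silent parameters
(`stub_paramDlogCertificate`); seven elements, no kink set, no Baker.

References: M. Kontsevich, D. Zagier, *Periods* (2001), §1.2 rule (2); J. Ayoub, Ann. of Math. 181 (2015), Rem. 1.5;
J. Fresán, *Une introduction aux périodes* (2024), Rem. 3.7.
-/

noncomputable section

set_option linter.dupNamespace false

namespace Summit.KontsevichZagierPeriods.KontsevichZagierPeriods.Cruxes.StokesGeneration.FibrewiseStokes

open MeasureTheory Set
open Literature.NumberTheory.Transcendental
open Literature.NumberTheory.Transcendental.KZ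
open Literature.ModelTheory.ExponentialFields (IsSemialgebraic)

/-- **S2 absorbs the dlog transposition for SEMIALGEBRAIC units (rung 10d; lead c5).** For positive `ℚ`-semialgebraic `C¹` functions
`p, q` on `[0,1]` (continuous with their derivatives `p′, q′` on `[0,1]`, differentiable on `(0,1)`) with the same logarithmic period
`p(1)/p(0) = q(1)/q(0)` and `γ` algebraic, `γ(p′(x₀)/p(x₀) − q′(x₁)/q(x₁))` is fibrewise-Stokes decomposable on the square — rung 6
(p128879) verbatim with functions: seven elements on `[0,1]⁴`, the semialgebraic closed-form transport (`stub_saSwapTransport`,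
p132805) and two parametrised rung-1 certificates (`stub_paramDlogCertificate`), Baker-free. [cite: KontsevichZagier2001, §1.2 rule (2)] -/
theorem fibStokesDecomposable_saDlogSwap (γ : ℝ) (p q p' q' : ℝ → ℝ) (hγ : IsAlgebraic ℚ γ)
    (hp : IsSemialgebraicFunOn ℚ (Set.pi Set.univ (fun _ : Fin 1 => Set.Icc (0:ℝ) 1)) (fun z => p (z 0))) (hq : IsSemialgebraicFunOn ℚ (Set.pi Set.univ (fun _ : Fin 1 => Set.Icc (0:ℝ) 1)) (fun z => q (z 0)))
    (hp' : IsSemialgebraicFunOn ℚ (Set.pi Set.univ (fun _ : Fin 1 => Set.Icc (0:ℝ) 1)) (fun z => p' (z 0))) (hq' : IsSemialgebraicFunOn ℚ (Set.pi Set.univ (fun _ : Fin 1 => Set.Icc (0:ℝ) 1)) (fun z => q' (z 0)))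
    (hpc : ContinuousOn p (Set.Icc (0:ℝ) 1)) (hqc : ContinuousOn q (Set.Icc (0:ℝ) 1))
    (hp'c : ContinuousOn p' (Set.Icc (0:ℝ) 1)) (hq'c : ContinuousOn q' (Set.Icc (0:ℝ) 1))
    (hpd : ∀ u ∈ Set.Ioo (0:ℝ) 1, HasDerivAt p (p' u) u) (hqd : ∀ u ∈ Set.Ioo (0:ℝ) 1, HasDerivAt q (q' u) u)
    (hppos : ∀ u ∈ Set.Icc (0:ℝ) 1, 0 < p u) (hqpos : ∀ u ∈ Set.Icc (0:ℝ) 1, 0 < q u)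
    (hrel : p 1 * q 0 = p 0 * q 1) :
    FibStokesDecomposable 2 (fun z => γ * (p' (z 0) / p (z 0) - q' (z 1) / q (z 1))) := by
  classical
  set S : Set (Fin 4 → ℝ) := Set.pi Set.univ (fun _ : Fin 4 => Set.Icc (0:ℝ) 1) with hS
  have hSsa : IsSemialgebraic ℚ S := by rw [hS, ← cube_eq_pi]; exact isSemialgebraic_cube
  have h24 : (2 : ℕ) ≤ 4 := by norm_num
  have hmem : ∀ x ∈ S, ∀ i, x i ∈ Set.Icc (0:ℝ) 1 := fun x hx i => hx i (Set.mem_univ _)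
  -- constants
  have h0m : (0:ℝ) ∈ Set.Icc (0:ℝ) 1 := ⟨le_rfl, zero_le_one⟩
  have h1m : (1:ℝ) ∈ Set.Icc (0:ℝ) 1 := ⟨zero_le_one, le_rfl⟩
  have hp0 : 0 < p 0 := hppos 0 h0m
  have hp1 : 0 < p 1 := hppos 1 h1m
  have hq0 : 0 < q 0 := hqpos 0 h0m
  have hq1 : 0 < q 1 := hqpos 1 h1m
  have hva : ∀ (g : ℝ → ℝ), IsSemialgebraicFunOn ℚ (Set.pi Set.univ (fun _ : Fin 1 => Set.Icc (0:ℝ) 1)) (fun z => g (z 0)) →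
      ∀ c ∈ Set.Icc (0:ℝ) 1, IsAlgebraic ℚ c → IsAlgebraic ℚ (g c) := fun g hg c hc hca =>
    hg.isAlgebraic_apply (a := fun _ => c) (fun _ _ => hc) fun _ => hca
  have hp0a : IsAlgebraic ℚ (p 0) := hva p hp 0 h0m isAlgebraic_zero
  have hp1a : IsAlgebraic ℚ (p 1) := hva p hp 1 h1m isAlgebraic_one
  have hq0a : IsAlgebraic ℚ (q 0) := hva q hq 0 h0m isAlgebraic_zero
  have hq1a : IsAlgebraic ℚ (q 1) := hva q hq 1 h1m isAlgebraic_one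
  -- semialgebraic / continuous atoms on the 4-cube
  have hpx : IsSemialgebraicFunOn ℚ S (fun x => p (x 0)) := (saSwapTrSC_coord hp hpc 0).1
  have hqx : IsSemialgebraicFunOn ℚ S (fun x => q (x 1)) := (saSwapTrSC_coord hq hqc 1).1
  have hcst : ∀ {c : ℝ}, IsAlgebraic ℚ c → IsSemialgebraicFunOn ℚ S (fun _ => c) := fun hc =>
    isSemialgebraicFunOn_const_of_isAlgebraic hSsa hc
  have hpxc : ContinuousOn (fun x : Fin 4 → ℝ => p (x 0)) S := (saSwapTrSC_coord hp hpc 0).2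
  have hqxc : ContinuousOn (fun x : Fin 4 → ℝ => q (x 1)) S := (saSwapTrSC_coord hq hqc 1).2
  have hpxpos : ∀ x ∈ S, 0 < p (x 0) := fun x hx => hppos _ (hmem x hx 0)
  have hqxpos : ∀ x ∈ S, 0 < q (x 1) := fun x hx => hqpos _ (hmem x hx 1)
  -- the two parametrised loops: numerator / denominator families
  let RA₁ : Fin 1 → (Fin 4 → ℝ) → ℝ := ![fun x => p 1 / q (x 1)]
  let RA₂ : Fin 2 → (Fin 4 → ℝ) → ℝ := ![fun x => p 0 / q (x 1), fun _ => p 1 / p 0]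
  let RB₁ : Fin 2 → (Fin 4 → ℝ) → ℝ := ![fun x => p (x 0) / q 1, fun _ => p 1 / p 0]
  let RB₂ : Fin 1 → (Fin 4 → ℝ) → ℝ := ![fun x => p (x 0) / q 0]
  obtain ⟨GA, DA, rA, hGA, hrA, hidA⟩ := stub_paramDlogCertificate γ 1 2 RA₁ RA₂ hγ
    (Fin.forall_fin_one.2 ((hcst hp1a).div hqx fun x hx => (hqxpos x hx).ne'))
    (Fin.forall_fin_two.2 ⟨(hcst hp0a).div hqx fun x hx => (hqxpos x hx).ne',
      hcst (mem_algebraicClosure_iff.mp (div_mem (mem_algebraicClosure_iff.mpr hp1a)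
        (mem_algebraicClosure_iff.mpr hp0a)))⟩)
    (Fin.forall_fin_one.2 fun x _ s _ => by simp [RA₁])
    (Fin.forall_fin_two.2 ⟨fun x _ s _ => by simp [RA₂],
      fun x _ s _ => by simp [RA₂]⟩)
    (Fin.forall_fin_one.2 fun x hx => div_pos hp1 (hqxpos x hx))
    (Fin.forall_fin_two.2 ⟨fun x hx => div_pos hp0 (hqxpos x hx), fun x _ => div_pos hp1 hp0⟩)
    (Fin.forall_fin_one.2 (continuousOn_const.div hqxc fun x hx => (hqxpos x hx).ne'))
    (Fin.forall_fin_two.2 ⟨continuousOn_const.div hqxc fun x hx => (hqxpos x hx).ne', continuousOn_const⟩)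
    (fun x hx => by
      simp only [RA₁, RA₂, Fin.prod_univ_one, Fin.prod_univ_two, Matrix.cons_val_zero, Matrix.cons_val_one,
        Matrix.cons_val_fin_one]
      field_simp)
  obtain ⟨GB, DB, rB, hGB, hrB, hidB⟩ := stub_paramDlogCertificate γ 2 1 RB₁ RB₂ hγ
    (Fin.forall_fin_two.2 ⟨hpx.div (hcst hq1a) fun x _ => hq1.ne',
      hcst (mem_algebraicClosure_iff.mp (div_mem (mem_algebraicClosure_iff.mpr hp1a)
        (mem_algebraicClosure_iff.mpr hp0a)))⟩)
    (Fin.forall_fin_one.2 (hpx.div (hcst hq0a) fun x _ => hq0.ne'))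
    (Fin.forall_fin_two.2 ⟨fun x _ s _ => by simp [RB₁],
      fun x _ s _ => by simp [RB₁]⟩)
    (Fin.forall_fin_one.2 fun x _ s _ => by simp [RB₂])
    (Fin.forall_fin_two.2 ⟨fun x hx => div_pos (hpxpos x hx) hq1, fun x _ => div_pos hp1 hp0⟩)
    (Fin.forall_fin_one.2 fun x hx => div_pos (hpxpos x hx) hq0)
    (Fin.forall_fin_two.2 ⟨hpxc.div continuousOn_const fun x _ => hq1.ne', continuousOn_const⟩)
    (Fin.forall_fin_one.2 (hpxc.div continuousOn_const fun x _ => hq0.ne'))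
    (fun x hx => by
      simp only [RB₁, RB₂, Fin.prod_univ_one, Fin.prod_univ_two, Matrix.cons_val_zero, Matrix.cons_val_one,
        Matrix.cons_val_fin_one]
      rw [div_mul_div_comm, div_eq_div_iff (mul_ne_zero hq1.ne' hp0.ne') hq0.ne']
      have := hpxpos x hx
      linear_combination p (x 0) * hrel)
  -- the closed-form transport
  obtain ⟨GT, DT, rT, hGT, hrT, hidT⟩ := stub_saSwapTransport γ p q p' q' hγ hp hq hp' hq' hpc hqc hp'c hq'c hpd hqd hppos hqpos
  -- assembling the seven elements
  let ι := Fin 3 ⊕ (Fin 2 ⊕ Fin 2)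
  let e : Fin (3 + (2 + 2)) ≃ ι := finSumFinEquiv.symm.trans (Equiv.sumCongr (Equiv.refl (Fin 3)) finSumFinEquiv.symm)
  let dirT : Fin 3 → Fin 4 := ![2, 0, 1]
  let dir : ι → Fin 4 := Sum.elim dirT (Sum.elim (fun j => Fin.natAdd 2 j) (fun j => Fin.natAdd 2 j))
  let Gι : ι → (Fin 4 → ℝ) → ℝ := Sum.elim GT (Sum.elim GA GB)
  let Dι : ι → (Fin 4 → ℝ) → ℝ := Sum.elim DT (Sum.elim DA DB)
  let qι : ι → IntegralRep 4 := Sum.elim rT (Sum.elim rA rB)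
  have hcond : ∀ s : ι, IsSemialgebraicFunOn ℚ S (Gι s) ∧ IsSemialgebraicFunOn ℚ S (Dι s) ∧
      IsSemialgebraic ℚ (∅ : Set (Fin 4 → ℝ)) ∧ (∃ B : ℝ, ∀ x ∈ S, |(Gι s) x| ≤ B) ∧
      (∀ x ∈ S, Set.Finite {s' : ℝ | Function.update x (dir s) s' ∈ (∅ : Set (Fin 4 → ℝ))}) ∧
      (∀ x ∈ S, ContinuousOn (fun s' : ℝ => (Gι s) (Function.update x (dir s) s')) (Set.Icc (0:ℝ) 1)) ∧
      (∀ x ∈ S, x ∉ (∅ : Set (Fin 4 → ℝ)) → x (dir s) ∈ Set.Ioo (0:ℝ) 1 →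
        HasDerivAt (fun s' : ℝ => (Gι s) (Function.update x (dir s) s')) ((Dι s) x) (x (dir s))) := by
    have pack : ∀ {Gf Df : (Fin 4 → ℝ) → ℝ} {d : Fin 4},
        (IsSemialgebraicFunOn ℚ S Gf ∧ IsSemialgebraicFunOn ℚ S Df ∧ (∃ B : ℝ, ∀ x ∈ S, |Gf x| ≤ B) ∧
          (∀ x ∈ S, ContinuousOn (fun s' : ℝ => Gf (Function.update x d s')) (Set.Icc (0:ℝ) 1)) ∧
          (∀ x ∈ S, x d ∈ Set.Ioo (0:ℝ) 1 →
            HasDerivAt (fun s' : ℝ => Gf (Function.update x d s')) (Df x) (x d))) →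
        IsSemialgebraicFunOn ℚ S Gf ∧ IsSemialgebraicFunOn ℚ S Df ∧
          IsSemialgebraic ℚ (∅ : Set (Fin 4 → ℝ)) ∧ (∃ B : ℝ, ∀ x ∈ S, |Gf x| ≤ B) ∧
          (∀ x ∈ S, Set.Finite {s' : ℝ | Function.update x d s' ∈ (∅ : Set (Fin 4 → ℝ))}) ∧
          (∀ x ∈ S, ContinuousOn (fun s' : ℝ => Gf (Function.update x d s')) (Set.Icc (0:ℝ) 1)) ∧
          (∀ x ∈ S, x ∉ (∅ : Set (Fin 4 → ℝ)) → x d ∈ Set.Ioo (0:ℝ) 1 →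
            HasDerivAt (fun s' : ℝ => Gf (Function.update x d s')) (Df x) (x d)) :=
      fun ⟨h1, h2, h3, h4, h5⟩ => ⟨h1, h2, Literature.ModelTheory.ExponentialFields.isSemialgebraic_empty, h3,
        fun x _ => by simp, h4, fun x hx _ hxj => h5 x hx hxj⟩
    rintro (j | (j | j))
    · exact pack (hGT j)
    · exact pack (hGA j)
    · exact pack (hGB j)
  have hqc : ∀ s : ι, (qι s).domain = S ∧ ∀ x ∈ S, (qι s).integrand x =
      Dι s x - (Gι s (Function.update x (dir s) 1) - Gι s (Function.update x (dir s) 0)) := by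
    rintro (j | (j | j))
    · exact hrT j
    · exact hrA j
    · exact hrB j
  refine ⟨4, h24, 3 + (2 + 2), fun j => dir (e j), fun j => Gι (e j), fun j => Dι (e j), fun _ => ∅,
    fun j => qι (e j), ∅, fun j => hcond (e j), fun j => hqc (e j),
    Literature.ModelTheory.ExponentialFields.isSemialgebraic_empty, measure_empty, fun x hx _ => ?_⟩
  have hsum : ∑ j : Fin (3 + (2 + 2)), (qι (e j)).integrand x = ∑ s : ι, (qι s).integrand x :=
    Equiv.sum_comp e (fun s => (qι s).integrand x)
  rw [hsum, Fintype.sum_sum_type, Fintype.sum_sum_type]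
  simp only [qι, Sum.elim_inl, Sum.elim_inr]
  rw [hidT x hx, ← hidA x hx, ← hidB x hx]
  simp only [RA₁, RA₂, RB₁, RB₂, Fin.sum_univ_one, Fin.sum_univ_two, Matrix.cons_val_zero, Matrix.cons_val_one,
    Matrix.cons_val_fin_one]
  show γ * (p' (x 0) / p (x 0) - q' (x 1) / q (x 1)) = _
  ring


end Summit.KontsevichZagierPeriods.KontsevichZagierPeriods.Cruxes.StokesGeneration.FibrewiseStokes

end
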